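import Literature.NumberTheory.Rogawski1990.LocalTransferTransportMeasure
import Literature.NumberTheory.Rogawski1990.LocalTransferCertification
import Literature.NumberTheory.Automorphic.OrbitalMeasureCanonical
import Literature.MeasureTheory.Group.InvariantQuotientTransport
import HarnessLib

/-!
# Canonical orbital measure families TRANSPORT along a bicontinuous isomorphism: `ψ_* m′` is canonical when `m′` is
(Rogawski (1990), §4.3 (4.3.1) p. 43: «the orbital integrals are defined using compatible measures on `H_{γ′}` and `G_γ`»; §14.2 p. 232:
«we fix an inner isomorphism `ψ : G′ → G`»; Deitmar–Echterhoff (2014), Thm. 1.5.3: the invariant quotient measure is canonical)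

Topic `NumberTheory/Rogawski1990`; namespace `Literature.NumberTheory.Rogawski1990` (sequel of ★ `LocalTransferTransportMeasure` (L6b) and of
★ (h) `LocalTransferCertification` ed. 2).  THEOREMS ONLY: no definition, no named fact, no instance, no `sorry`.  Cell `pub/hodgecm-mathlib`,
ENGINE T1, SPEC-ed1.19 §0 (C-fin) «finite places ABSOLUTE canonical … transport-invariant (★ `image_compactCore`) ⇒ corresponding regular elements
get transported torus measures for free» — made a theorem for the ψ-transport that DEFINES the kit's quasi-split family
`ComparisonKit.mq 𝔨 v := (𝔨.mG v).transport (𝔨.ψ v).toMulEquiv (𝔨.ψ v).continuous (𝔨.ψ v).symm.continuous` (SPEC-ed1.19 §2 (mq)).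

* §1 **`OrbitalMeasureFamily.IsCanonical.transport`** (generic `ψ : B ≃* A` bicontinuous between unimodular locally compact second countable
  groups): if `m′` is canonical (★ `OrbitalMeasureFamily.IsCanonical`, F0-typ1 O9) on the `Q`-classes of `B` for the Haar measure `ν′`, `Q` is a
  class function with `P a → Q (ψ⁻¹ a)`, and `ν = ψ_* ν′`, then `ψ_* m′` (★ `OrbitalMeasureFamily.transport`) is canonical on the `P`-classes of
  `A` for `ν`.  Proof at a `P`-class `c`, with `e_c = conj(x_c) ∘ ψ` the identification chosen inside `transport` (`e_c (out ψ⁻¹c) = out c`):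
  `(ψ_* m′) c = (x_c⁻¹ • ·)_* (cosetCongr e_c)_* (dν′ ∕ dt′)` (★ `transport_apply`) `= (cosetCongr e_c)_* (dν′ ∕ dt′)` (invariance)
  `= d((e_c)_* ν′) ∕ d((e_c)|_* t′)` (★ `map_cosetCongr_quotientMeasure`) and `(e_c)_* ν′ = (conj x_c)_* ν = ν` (Mathlib
  `map_mul_left_eq_self` ∕ `map_mul_right_eq_self`); the transported torus measure `(e_c)|_* t′` is Haar (Mathlib `MulEquiv.isHaarMeasure_map`),
  inversion invariant, and gives mass `1` to the compact core (★ `image_compactCore`).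
* §2 the CM dress **`transport_isCanonical_isRegularElt`**: for `ψ_v : U(H)(L⁺_v) ≃ₜ* U(Φ₃)(L⁺_v)` with `ψ_v⁻¹ γ ↔ γ` (★ `Corresponds`) and
  `mG v` canonical on the regular classes for `ν′`, the transported family is canonical on the regular classes for `(ψ_v)_* ν′` (regularity is a
  class function preserved by correspondence, ★ (h) `isRegularElt_iff_of_isConj_local` ∕ ★ `isRegularElt_of_isConj`).
Which local Haar measure the line fixes on `U(Φ₃)(L⁺_v)` (`(ψ_v)_* ν_{G′,v}` itself, or a given `ν_{G,v}` shown equal to it by Haar uniqueness,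
`ν(K_v) = 1` on both sides and (Ψ⁺)'s level matching off `S₀`) is the LEAD's convention; the hypothesis `hν : ν = ν′.map ψ` serves either.
HC_CM is proved only modulo the printed citations until rung 0 closes; this file is unconditional.

## References
* [Rogawski1990] J. D. Rogawski, *Automorphic Representations of Unitary Groups in Three Variables*, Ann. of Math. Stud. 123 (1990), §4.3 (4.3.1)
  p. 43, §14.2 (14.2.1) p. 232.
* [DeitmarEchterhoff2014] A. Deitmar, S. Echterhoff, *Principles of Harmonic Analysis*, 2nd ed. (2014), Thm. 1.5.3.
* [Gelbart1975] S. Gelbart, *Automorphic forms on adele groups*, Ann. of Math. Stud. 83 (1975), §10 pp. 154–155 (measures matched along `G_S = G′_S`).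
-/

set_option autoImplicit false

noncomputable section

open MeasureTheory Measure Set
open Literature.MeasureTheory.Group
open scoped ENNReal NNReal

namespace Literature.NumberTheory.Rogawski1990

open Literature.NumberTheory.Automorphic Topology

/-! ## §1 Generic: canonical families transport along a bicontinuous `ψ : B ≃* A` -/

section CanonicalTransport

variable {A B : Type*} [Group A] [Group B] [TopologicalSpace A] [TopologicalSpace B] [IsTopologicalGroup A] [IsTopologicalGroup B]
  [LocallyCompactSpace A] [LocallyCompactSpace B] [SecondCountableTopology A] [SecondCountableTopology B] [T2Space A] [T2Space B]
  [MeasurableSpace A] [BorelSpace A] [MeasurableSpace B] [BorelSpace B]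
  [∀ a : A, MeasurableSpace (A ⧸ Subgroup.centralizer ({a} : Set A))] [∀ a : A, BorelSpace (A ⧸ Subgroup.centralizer ({a} : Set A))]
  [∀ b : B, MeasurableSpace (B ⧸ Subgroup.centralizer ({b} : Set B))] [∀ b : B, BorelSpace (B ⧸ Subgroup.centralizer ({b} : Set B))]
  (ψ : B ≃* A) (hψ : Continuous ψ) (hψs : Continuous ψ.symm)

/-- **Canonical families transport**: if `m′` is canonical on the `Q`-classes of `B` for the Haar measure `ν′`, `ψ : B ≃* A` is bicontinuous,
`Q` is a class function with `P a → Q (ψ⁻¹ a)`, and `ν = ψ_* ν′`, then `ψ_* m′` (★ `OrbitalMeasureFamily.transport`) is canonical on the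
`P`-classes of `A` for `ν`: at a `P`-class `c`, `(ψ_* m′) c = (cosetCongr e_c)_* (dν′ ∕ dt′) = d(e_c)_*ν′ ∕ d(e_c)_*t′` (naturality of the
quotient measure, ★ `map_cosetCongr_quotientMeasure`; the left translation inside `transport` is invisible on the invariant quotient measure),
`(e_c)_* ν′ = (conj x_c)_* ψ_* ν′ = ν` (a Haar measure on the unimodular `A` is conjugation invariant), and the transported torus measure
`(e_c)_* t′` is Haar, inversion invariant and gives mass `1` to the compact core (★ `image_compactCore`: the compact core is intrinsic).
[cite: Rogawski1990, §4.3 (4.3.1) p. 43] [cite: DeitmarEchterhoff2014, Thm. 1.5.3] -/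
theorem _root_.Literature.NumberTheory.Automorphic.OrbitalMeasureFamily.IsCanonical.transport
    {P : A → Prop} {Q : B → Prop} (hQ : ∀ b b', IsConj b b' → (Q b ↔ Q b')) (hPQ : ∀ a, P a → Q (ψ.symm a))
    (ν' : Measure B) [ν'.IsHaarMeasure] [ν'.IsMulRightInvariant] (ν : Measure A) [ν.IsHaarMeasure] [ν.IsMulRightInvariant]
    (hν : ν = ν'.map ψ) {m' : OrbitalMeasureFamily B} (h : m'.IsCanonical Q ν') :
    (m'.transport ψ hψ hψs).IsCanonical P ν := by
  intro c hc
  have hQ' : Q (Quotient.out (preClass ψ c) : B) := (hQ _ _ (isConj_out_preClass ψ c)).2 (hPQ _ hc)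
  obtain ⟨t', ht', hti', ht'1, hm'⟩ := h (preClass ψ c) hQ'
  -- the identification `e = conj(x_c) ∘ ψ : B ≃* A`, `e (out (ψ⁻¹ c)) = out c`, and its restriction to the centralisers
  have he : Continuous (transportEquiv ψ c) := continuous_transportEquiv ψ hψ c
  have hes : Continuous (transportEquiv ψ c).symm := continuous_transportEquiv_symm ψ hψs c
  have hCC := forall_apply_mem_centralizer_singleton_iff_of_eq (transportEquiv ψ c) (transportEquiv_out ψ c)
  haveI : LocallyCompactSpace (Subgroup.centralizer ({(Quotient.out (preClass ψ c) : B)} : Set B)) :=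
    (isClosed_coe_centralizer_singleton (Quotient.out (preClass ψ c))).isClosedEmbedding_subtypeVal.locallyCompactSpace
  haveI : LocallyCompactSpace (Subgroup.centralizer ({(Quotient.out c : A)} : Set A)) :=
    (isClosed_coe_centralizer_singleton (Quotient.out c)).isClosedEmbedding_subtypeVal.locallyCompactSpace
  let E : Subgroup.centralizer ({(Quotient.out (preClass ψ c) : B)} : Set B) ≃* Subgroup.centralizer ({(Quotient.out c : A)} : Set A) :=
    { toFun := fun z => ⟨transportEquiv ψ c z, (hCC z).2 z.2⟩
      invFun := fun z => ⟨(transportEquiv ψ c).symm z, (forall_symm_mem_iff (transportEquiv ψ c) _ _ hCC z).2 z.2⟩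
      left_inv := fun z => Subtype.ext ((transportEquiv ψ c).symm_apply_apply z)
      right_inv := fun z => Subtype.ext ((transportEquiv ψ c).apply_symm_apply z)
      map_mul' := fun z w => Subtype.ext (map_mul (transportEquiv ψ c) (z : B) (w : B)) }
  have hEc : Continuous E := (he.comp continuous_subtype_val).subtype_mk _
  have hEsc : Continuous E.symm := (hes.comp continuous_subtype_val).subtype_mk _
  let Et : Subgroup.centralizer ({(Quotient.out (preClass ψ c) : B)} : Set B) ≃ₜ* Subgroup.centralizer ({(Quotient.out c : A)} : Set A) :=
    { E with continuous_toFun := hEc, continuous_invFun := hEsc }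
  have hEeq : (⇑(subgroupCongrHomeomorph (transportEquiv ψ c) _ _ hCC he hes) :
      Subgroup.centralizer ({(Quotient.out (preClass ψ c) : B)} : Set B) → Subgroup.centralizer ({(Quotient.out c : A)} : Set A)) = ⇑E := rfl
  -- the transported torus measure
  set t : Measure (Subgroup.centralizer ({(Quotient.out c : A)} : Set A)) :=
    t'.map (subgroupCongrHomeomorph (transportEquiv ψ c) _ _ hCC he hes) with ht
  haveI : t.IsHaarMeasure := by rw [ht, hEeq]; exact E.isHaarMeasure_map t' hEc hEsc
  haveI : t.IsInvInvariant := by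
    refine ⟨?_⟩
    rw [Measure.inv_def, ht, hEeq, Measure.map_map measurable_inv hEc.measurable,
      show (Inv.inv ∘ ⇑E) = ⇑E ∘ Inv.inv from funext fun z => (map_inv E z).symm,
      ← Measure.map_map hEc.measurable measurable_inv, Measure.map_inv_eq_self]
  refine ⟨t, ‹_›, ‹_›, ?_, ?_⟩
  · -- mass one on the compact core: the compact core is intrinsic
    have hME : (⇑E : _ → _) = ⇑(Homeomorph.mk E.toEquiv hEc hEsc).toMeasurableEquiv := rfl
    rw [ht, hEeq, hME, MeasurableEquiv.map_apply]
    have hpre : ⇑(Homeomorph.mk E.toEquiv hEc hEsc).toMeasurableEquiv ⁻¹' compactCore (Subgroup.centralizer ({(Quotient.out c : A)} : Set A)) =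
        compactCore (Subgroup.centralizer ({(Quotient.out (preClass ψ c) : B)} : Set B)) := by
      rw [← image_compactCore Et.symm]
      exact (Equiv.image_symm_eq_preimage E.toEquiv _).symm
    rw [hpre]
    exact ht'1
  · -- `(ψ_* m′) c = dν ∕ dt`
    have hνe : ν = Measure.map (transportEquiv ψ c) ν' := by
      rw [show (⇑(transportEquiv ψ c) : B → A) = ((fun a => a * (transportConj ψ c)⁻¹) ∘ (fun a => transportConj ψ c * a)) ∘ ψ from
          funext fun b => by simp [transportEquiv_apply],
        ← Measure.map_map ((measurable_mul_const _).comp (measurable_const_mul _)) hψ.measurable, ← hν,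
        ← Measure.map_map (measurable_mul_const _) (measurable_const_mul _), map_mul_left_eq_self, map_mul_right_eq_self]
    rw [transport_apply, hm',
      map_cosetCongr_quotientMeasure (transportEquiv ψ c) he hes _ _ hCC t' t ν' ν ht hνe
        (hH := isClosed_coe_centralizer_singleton _) (hH' := isClosed_coe_centralizer_singleton _)]
    haveI := smulInvariantMeasure_quotientMeasure (Subgroup.centralizer ({(Quotient.out c : A)} : Set A)) t
      (isClosed_coe_centralizer_singleton (Quotient.out c)) ν
    exact MeasureTheory.map_smul _ _

end CanonicalTransport

/-! ## §2 The CM dress: the kit's `mq v = (ψ_v)_* mG v` is canonical on the regular classes -/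

section CMDress

open NumberField IsDedekindDomain
open scoped Matrix MatrixGroups

variable (L : Type) [Field L] [NumberField L] [IsCMField L] (H : Matrix (Fin 3) (Fin 3) L)
  (v : HeightOneSpectrum (𝓞 ↥(maximalRealSubfield L)))
  [MeasurableSpace ((UnitaryGroup.cmDatum L 3 H).Local v)] [BorelSpace ((UnitaryGroup.cmDatum L 3 H).Local v)]
  [MeasurableSpace ((UnitaryGroup.cmDatum L 3 (Matrix.of fun i j : Fin 3 => if i.val + j.val + 1 = 3 then (1 : L) else 0)).Local v)]
  [BorelSpace ((UnitaryGroup.cmDatum L 3 (Matrix.of fun i j : Fin 3 => if i.val + j.val + 1 = 3 then (1 : L) else 0)).Local v)]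
  [∀ γ : (UnitaryGroup.cmDatum L 3 H).Local v,
    MeasurableSpace ((UnitaryGroup.cmDatum L 3 H).Local v ⧸ Subgroup.centralizer ({γ} : Set ((UnitaryGroup.cmDatum L 3 H).Local v)))]
  [∀ γ : (UnitaryGroup.cmDatum L 3 H).Local v,
    BorelSpace ((UnitaryGroup.cmDatum L 3 H).Local v ⧸ Subgroup.centralizer ({γ} : Set ((UnitaryGroup.cmDatum L 3 H).Local v)))]
  [∀ γ : (UnitaryGroup.cmDatum L 3 (Matrix.of fun i j : Fin 3 => if i.val + j.val + 1 = 3 then (1 : L) else 0)).Local v,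
    MeasurableSpace ((UnitaryGroup.cmDatum L 3 (Matrix.of fun i j : Fin 3 => if i.val + j.val + 1 = 3 then (1 : L) else 0)).Local v ⧸
      Subgroup.centralizer ({γ} : Set ((UnitaryGroup.cmDatum L 3 (Matrix.of fun i j : Fin 3 => if i.val + j.val + 1 = 3 then (1 : L) else 0)).Local v)))]
  [∀ γ : (UnitaryGroup.cmDatum L 3 (Matrix.of fun i j : Fin 3 => if i.val + j.val + 1 = 3 then (1 : L) else 0)).Local v,
    BorelSpace ((UnitaryGroup.cmDatum L 3 (Matrix.of fun i j : Fin 3 => if i.val + j.val + 1 = 3 then (1 : L) else 0)).Local v ⧸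
      Subgroup.centralizer ({γ} : Set ((UnitaryGroup.cmDatum L 3 (Matrix.of fun i j : Fin 3 => if i.val + j.val + 1 = 3 then (1 : L) else 0)).Local v)))]

/-- **The kit's quasi-split family `mq v := (ψ_v)_* mG v` is CANONICAL on the regular classes** of `U(Φ₃)(L⁺_v)` for the local Haar measure
`ν = (ψ_v)_* ν′` when `mG v` is canonical on the regular classes of `U(H)(L⁺_v)` for `ν′` and `ψ_v⁻¹ γ ↔ γ` for every `γ` (regularity is a
class function, ★ `isRegularElt_iff_of_isConj_local`, preserved by correspondence, ★ `isRegularElt_of_isConj`). SPEC-ed1.19 §0 (C-fin).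
[cite: Rogawski1990, §4.3 (4.3.1) p. 43; §14.2 p. 232] -/
theorem transport_isCanonical_isRegularElt
    (ψ : (UnitaryGroup.cmDatum L 3 H).Local v ≃ₜ*
      (UnitaryGroup.cmDatum L 3 (Matrix.of fun i j : Fin 3 => if i.val + j.val + 1 = 3 then (1 : L) else 0)).Local v)
    (hcl' : ∀ γ, Corresponds (UnitaryGroup.conjLocal L (IsCMField.complexConj L) v)
      ((UnitaryGroup.adelicForm L 3 H).map (UnitaryGroup.adeleToLocal L v))
      ((UnitaryGroup.adelicForm L 3 (Matrix.of fun i j : Fin 3 => if i.val + j.val + 1 = 3 then (1 : L) else 0)).map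
        (UnitaryGroup.adeleToLocal L v)) (ψ.symm γ) γ)
    (ν' : Measure ((UnitaryGroup.cmDatum L 3 H).Local v)) [ν'.IsHaarMeasure] [ν'.IsMulRightInvariant]
    (ν : Measure ((UnitaryGroup.cmDatum L 3 (Matrix.of fun i j : Fin 3 => if i.val + j.val + 1 = 3 then (1 : L) else 0)).Local v))
    [ν.IsHaarMeasure] [ν.IsMulRightInvariant] (hν : ν = ν'.map ψ)
    {m' : OrbitalMeasureFamily ((UnitaryGroup.cmDatum L 3 H).Local v)}
    (hm' : m'.IsCanonical (fun γ => IsRegularElt (γ.val : GL (Fin 3) (UnitaryGroup.LocalRing L v))) ν') :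
    (m'.transport ψ.toMulEquiv ψ.continuous ψ.symm.continuous).IsCanonical
      (fun γ => IsRegularElt (γ.val : GL (Fin 3) (UnitaryGroup.LocalRing L v))) ν :=
  hm'.transport ψ.toMulEquiv ψ.continuous ψ.symm.continuous (fun _ _ h => isRegularElt_iff_of_isConj_local L H v h)
    (fun γ hγ => isRegularElt_of_isConj (hcl' γ).symm hγ) ν' ν hν

end CMDress

end Literature.NumberTheory.Rogawski1990

end
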